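import Literature.NumberTheory.EllipticCurves.CuspFormLFunctionLevelConductorOfCarayolProofs
import Literature.NumberTheory.EllipticCurves.NewformGaloisRepEulerFactors
import Literature.NumberTheory.EllipticCurves.TateModuleTwistNewformEulerFactorsProofs
import Literature.NumberTheory.EllipticCurves.HasseWeilAbelianEulerFactorForallProofs
import Literature.NumberTheory.EllipticCurves.RootNumberAtkinLehnerSemistableProofs
import Literature.NumberTheory.EllipticCurves.LocalTorsionNonsplitMultiplicativeVanishingProofs
import Literature.NumberTheory.EllipticCurves.Szpiro
import Literature.NumberTheory.EllipticCurves.SzpiroFreyProofs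
import Literature.NumberTheory.GaloisRepresentations.CoinvariantsCharpolyBaseChange
import Literature.NumberTheory.DiophantineGeometry.ConductorAdditiveProofs
import Literature.NumberTheory.DiophantineGeometry.GeneralizedFermatTwoPowerCoefficientFreyProofs
import Literature.NumberTheory.Automorphic.CDTTheorem722
import Literature.NumberTheory.Automorphic.BCDTModularity
import HarnessLib

/-!
# stub-ideation k3 (gen 6, FAMILY 3 — probe the extremes) for `stub_threeImpTwo` (S9) of crux
`FreyModularity` (stmt-ABC-11340), line `Sketch` — companion to `STUB-IDEAS-stub_threeImpTwo-3.md`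

Gen 5 (all three ideators converged): S9 ⇐ {a.e. PACKET off its level (k2, PROVED from two primes /
k1 hole-filler), Carayol's CONDUCTOR theorem `Carayol1986_artinConductorExponent` (C_A) + Saito at `2`
(level `N = N_W`, k3 L0, PROVED modulo the named facts), and ONE residual Euler-factor datum: the
STEINBERG SIGN BIT `a_p(f₀) = a_p(W) ∈ {±1}` at `p ∥ N` (k3 L2 `SteinbergSignPacket`), which gen 5 took
from the whole of `Carayol1986_eulerFactor` (C_E) with a `sorry`'d pointer to k1's port}.

**Gen 6 pushes the extreme to its corner and closes the glue (0 `sorry` outside the Frey helper stubs):**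

* G6a `CarayolSteinbergGamma0` — the SMALLEST literature-shaped target: C_E restricted to `Γ₀(N)`-newforms
  of weight `2` (trivial nebentypus) and to primes `ℓ ∥ N` (Steinberg local component): "the arithmetic
  Frobenius acts on the inertia COINVARIANT line of `ρ_{f₀,p}` at `ℓ` by `a_ℓ(f₀)`", i.e.
  Darmon–Diamond–Taylor Thm. 3.1 (e), first case (Deligne–Rapoport at `p ∥ N`; Langlands 1973 / Carayol
  1986 Thm. (A) in general).  `carayolSteinbergGamma0_of_carayol1986_eulerFactor : C_E → G6a` (PROVED).
* G6b `cuspCoeff_eq_lFunction_of_carayolSteinbergGamma0` — G6a ⇒ `a_p(f₀) = a_p(W)` at every `p ∥ N`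
  for the packet (PROVED: L0a with the frame exposed, coinvariants/base-change/conjugation transport,
  the tree's `reverse_charpoly_toInertiaCoinvariants_eq_localPolynomialAt'`, `X`-coefficient by
  reduction type).  Hence `steinbergSignPacket_of_carayolSteinbergGamma0` and gen 5's L2a
  `steinbergSignPacket_of_carayol1986_eulerFactor` are now PROVED, and the VERBATIM stub follows from
  {`SomeLevelPacket`, C_A, Saito-at-2, `CarayolSteinbergGamma0`} (`stub_threeImpTwo_of_steinberg_leaves`).
* G6c the opposite corner, PROVED with NO Euler-factor input: a curve whose conductor is squarefull
  (every bad prime additive) — `isModular_of_packet_of_carayol1986_of_saito_of_squarefull`.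
* G6d the route's instances: Frey curves `E_{A,B}` are multiplicative at every odd bad prime, with
  EXPLICIT sign `a_q = (B/q), (-A/q), (A/q)` for `q ∣ A`, `q ∣ B`, `q ∣ A+B` (helper stubs F1a–c, `sorry`,
  M each; kit job j344703 of gen 5: 0/11756 mismatches) and the cut residual `FreySteinbergSign`
  (⇐ `SteinbergSignPacket`, PROVED): the minimal counterexample to S9 on the route is a packet newform of
  level `N_{E_{A,B}}` with `a_q(f₀) = -(B/q)` at some odd `q ∣ A`.

[cite: CarayolASENS1986, Thm. (A), (0.8) Corollaire (pp. 410–411)]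
[cite: DarmonDiamondTaylor1995, Thm. 3.1 (d), (e) (pp. 86–87)] [cite: DeligneRapoport1973, VII §5]
[cite: Saito1988, Theorem 1] [cite: AtkinLehner1970, Thm. 3] [cite: DiamondShurman2005, Thm. 8.8.1, §8.8]
[cite: BCDTJAMS2001, Introduction ((3) ⇒ (2))] [cite: SilvermanAEC2009, §C.16, VII.5 Prop. 5.1 (b)]
[cite: Serre1987, §4.1 (4.1.2)]
-/

noncomputable section

open scoped NumberField Polynomial MatrixGroups ModularForm
open NumberField IsDedekindDomain Field Polynomial Matrix Rat.HeightOneSpectrum CongruenceSubgroup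
  Literature.NumberTheory.GaloisRepresentations Literature.NumberTheory.EllipticCurves
  Literature.NumberTheory.EllipticCurves.ModularForms Literature.NumberTheory.Automorphic
  WeierstrassCurve

namespace Summit.ABC.ABC.Cruxes.FreyModularity.Sketch.ThreeImpTwoIdeas3g6

/-! ## L0 — the level leaf on the PACKET (Carayol (A) + Saito at `2`; no Euler factors) -/

section LevelLeaf

variable (W : WeierstrassCurve ℚ) [W.IsElliptic] {N : ℕ} [NeZero N] (f₀ : CuspForm (Gamma0 N) 2)

omit [W.IsElliptic] in
/-- A `Γ₀(N)`-newform is not the zero form (`a₁ = 1`). [folklore] -/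
theorem ne_zero_of_isNewform0 (hf₀ : IsNewform0 f₀) : f₀ ≠ 0 := by
  intro h0
  have h1 : cuspCoeff f₀ 1 = 1 := hf₀.2.2
  rw [h0, cuspCoeff, CuspForm.coe_zero, UpperHalfPlane.qExpansion_zero, map_zero] at h1
  exact zero_ne_one h1

omit [W.IsElliptic] in
/-- **The Hecke polynomial of the `Γ₁(N)`-lift of `f₀` at a prime `q ∤ N` carrying `a_q(W)`**, read in
`ℚ̄_ℓ`: `X² - a_q(W) X + q` (the tree's private `IsNewformOf.map_heckePolynomial_liftToGamma1` with
`IsNewformOf` weakened to the single coefficient `a_q(f₀) = a_q(W)`). [folklore] -/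
theorem map_heckePolynomial_liftToGamma1_of_cuspCoeff_eq (hne : f₀ ≠ 0) (ℓ : ℕ) [Fact ℓ.Prime]
    (ι : PadicAlgCl ℓ ≃+* ℂ) {q : ℕ} (hq : q.Prime) (hqN : ¬ q ∣ N)
    (ha : cuspCoeff f₀ q = (W.LFunction q : ℂ)) :
    (heckePolynomial (liftToGamma1 N 2 f₀) q).map
        ((ι.symm : ℂ →+* PadicAlgCl ℓ).comp (algebraMap (coeffCharField (liftToGamma1 N 2 f₀)) ℂ)) =
      X ^ 2 - C ((W.LFunction q : ℤ) : PadicAlgCl ℓ) * X + C ((q : ℕ) : PadicAlgCl ℓ) := by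
  rw [← Polynomial.map_map, map_heckePolynomial, coe_liftToGamma1_holds N 2 f₀]
  have ha' : (UpperHalfPlane.qExpansion 1 ⇑f₀).coeff q = (W.LFunction q : ℂ) := ha
  have hε : nebentypus (liftToGamma1 N 2 f₀) (q : ZMod N) = 1 := by
    rw [nebentypus_liftToGamma1_holds N 2 hne,
      MulChar.one_apply ((ZMod.isUnit_prime_iff_not_dvd hq).mpr hqN)]
  rw [ha', hε]
  have h21 : ((2 : ℤ) - 1) = 1 := by norm_num
  simp [Polynomial.map_sub, Polynomial.map_add, Polynomial.map_mul, h21]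

/-- **L0a — the `ℓ`-adic Tate module of `W` is an irreducible `ℓ`-adic representation attached to the
lift of the PACKET newform `f₀`.**  For an elliptic `W/ℚ`, a newform `f₀ ∈ S₂(Γ₀(N))` with `W` good off
`N` and `a_p(f₀) = a_p(W)` for every prime `p ∤ N` (k2's packet; NO hypothesis at `p ∣ N`), a prime `ℓ`
with `V_ℓ W` irreducible and `ι : ℚ̄_ℓ ≃ ℂ`: a framed model of `V_ℓ W ⊗ ℚ̄_ℓ` is attached to
`liftToGamma1 N 2 f₀` away from `N ℓ`, is irreducible, and has Artin exponent `a_w(V_ℓ W)` at every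
`w ∤ ℓ`.  Port of the tree's `IsNewformOf.exists_isGaloisRepOfNewform1_rationalTate`
(`CuspFormLFunctionLevelConductorCarayolProofs`), whose proof used `IsNewformOf` only through
`a_q(f) = a_q(W)` and good reduction at `q ∤ N`.
[cite: DarmonDiamondTaylor1995, Thm. 3.1 (b), (c) and p. 87] [cite: SilvermanAEC2009, C.21 Remark 21.3] -/
theorem exists_isGaloisRepOfNewform1_rationalTate_of_packet (hf₀ : IsNewform0 f₀)
    (hgood : ∀ v : HeightOneSpectrum (𝓞 ℚ), ¬ ((primesEquiv v : ℕ) ∣ N) → W.HasGoodReductionAt v)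
    (hap : ∀ p : ℕ, p.Prime → ¬ p ∣ N → cuspCoeff f₀ p = (W.LFunction p : ℂ))
    (ℓ : ℕ) [Fact ℓ.Prime] (ι : PadicAlgCl ℓ ≃+* ℂ)
    (hirr : (W.rationalGaloisRepTate ℓ).IsIrreducible) :
    ∃ ρ : FramedGaloisRep ℚ (PadicAlgCl ℓ) 2,
      IsGaloisRepOfNewform1 (liftToGamma1 N 2 f₀)
          ((ι.symm : ℂ →+* PadicAlgCl ℓ).comp (algebraMap (coeffCharField (liftToGamma1 N 2 f₀)) ℂ))
          {q | q ∣ N * ℓ} ρ ∧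
        ρ.toGaloisRep.IsIrreducible ∧
        ∀ w : HeightOneSpectrum (𝓞 ℚ), (ℓ : 𝓞 ℚ) ∉ w.asIdeal →
          ρ.toGaloisRep.artinConductorExponent w =
            conductorExponentOf (WeierstrassCurve.geomPoints W) ℓ
              (W.continuous_rationalGaloisRepTate_holds ℓ) w := by
  classical
  have hℓp : ℓ.Prime := Fact.out
  have hne : f₀ ≠ 0 := ne_zero_of_isNewform0 f₀ hf₀
  obtain ⟨VQ, eV, heV, hV⟩ := exists_framedGaloisRep_rationalTate W ℓ
  set iE := algebraMap ℚ_[ℓ] (PadicAlgCl ℓ) with hiE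
  have hiEc : Continuous iE := continuous_algebraMap_padicAlgCl ℓ
  have hcW := W.continuous_rationalGaloisRepTate_holds ℓ
  have heV' : ∀ (g : absoluteGaloisGroup ℚ) (x : Fin 2 → ℚ_[ℓ]),
      eV (VQ.toGaloisRep g x) =
        rationalTateGaloisRepOf (WeierstrassCurve.geomPoints W) ℓ hcW g (eV x) := heV
  refine ⟨FramedRep.baseChange iE hiEc VQ, ?_, ?_, ?_⟩
  · -- attached to the lift of `f₀` away from `N ℓ`
    intro v hvS
    set q : ℕ := ((primesEquiv v : Nat.Primes) : ℕ) with hqdef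
    have hq : q.Prime := (primesEquiv v).2
    simp only [Set.mem_setOf_eq] at hvS
    have hqN : ¬ q ∣ N := fun h ↦ hvS (h.trans (dvd_mul_right N ℓ))
    have hqℓ : q ≠ ℓ := fun h ↦ hvS (h ▸ dvd_mul_left q N)
    have hℓv : (ℓ : 𝓞 ℚ) ∉ v.asIdeal := by
      rw [Rat.natCast_mem_asIdeal_iff]
      intro h
      exact hqℓ ((Nat.prime_dvd_prime_iff_eq hq hℓp).mp h)
    have hgoodv : W.HasGoodReductionAt v := hgood v hqN
    obtain ⟨hVu, hVf⟩ := hV v hℓv hgoodv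
    refine ⟨(FramedGaloisRep.isUnramifiedAt_baseChange_iff iE hiEc iE.injective v VQ).mpr hVu, ?_⟩
    rw [map_heckePolynomial_liftToGamma1_of_cuspCoeff_eq W f₀ hne ℓ ι hq hqN (hap q hq hqN)]
    have hVf' := FramedGaloisRep.hasFrobCharpolyAt_baseChange iE hiEc hVf
    have hmapQ : (X ^ 2 - C ((W.LFunction q : ℤ) : ℚ_[ℓ]) * X + C (q : ℚ_[ℓ]) : ℚ_[ℓ][X]).map iE =
        X ^ 2 - C ((W.LFunction q : ℤ) : PadicAlgCl ℓ) * X + C (q : PadicAlgCl ℓ) := by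
      simp
    rw [hmapQ] at hVf'
    exact hVf'
  · -- irreducible: `V_ℓ W` is odd and irreducible, hence absolutely irreducible
    have hirrQ : FramedRep.IsIrreducible VQ :=
      (Representation.isIrreducible_iff_of_equivariant VQ.toRepresentation (W.rationalGaloisRepTate ℓ)
        (MonoidHom.id _) Function.surjective_id eV heV).mpr hirr
    obtain ⟨c, hc⟩ := exists_isComplexConjugation (Rat.castHom ℝ)
    have hcc : c * c = 1 := by rw [← pow_two]; exact hc.sq_eq_one
    have hdet : Matrix.GeneralLinearGroup.det (VQ c) = -1 := by
      apply Units.ext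
      rw [Matrix.GeneralLinearGroup.val_det_apply, Units.val_neg, Units.val_one]
      have h1 : ((VQ c : GL (Fin 2) ℚ_[ℓ]) : Matrix (Fin 2) (Fin 2) ℚ_[ℓ]).det =
          LinearMap.det (VQ.toRepresentation c) := by
        rw [← LinearMap.det_toLin']
        rfl
      have h2 : LinearMap.det (VQ.toRepresentation c) =
          LinearMap.det (W.rationalGaloisRepTate ℓ c) := by
        have hconj : (W.rationalGaloisRepTate ℓ c : W.rationalTateModule ℓ →ₗ[ℚ_[ℓ]] _) =
            (eV : (Fin 2 → ℚ_[ℓ]) →ₗ[ℚ_[ℓ]] W.rationalTateModule ℓ) ∘ₗ VQ.toRepresentation c ∘ₗ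
              (eV.symm : W.rationalTateModule ℓ →ₗ[ℚ_[ℓ]] (Fin 2 → ℚ_[ℓ])) := by
          apply LinearMap.ext
          intro y
          simp only [LinearMap.coe_comp, LinearEquiv.coe_coe, Function.comp_apply]
          rw [heV, LinearEquiv.apply_symm_apply]
        rw [hconj, LinearMap.det_conj]
      rw [h1, h2, Literature.AlgebraicGeometry.Motives.det_rationalGaloisRepTate_eq_cyclotomicCharacter
        W ℓ c, GaloisRep.cyclotomicCharacter_of_isComplexConjugation ℓ hc, map_neg, map_one]
    have habs : FramedRep.IsAbsolutelyIrreducible VQ :=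
      FramedRep.isAbsolutelyIrreducible_of_isIrreducible_of_det_eq_neg_one VQ hirrQ two_ne_zero hcc
        hdet
    exact habs (PadicAlgCl ℓ) iE
  · -- conductor exponents away from `ℓ`
    intro w _
    rw [FramedGaloisRep.artinConductorExponent_toGaloisRep_baseChange]
    exact GaloisRep.artinConductorExponent_eq_of_equiv VQ.toGaloisRep
      (rationalTateGaloisRepOf (WeierstrassCurve.geomPoints W) ℓ hcW) eV heV' w

/-- **L0b — `v_q(N) = f_w(W)` for the packet at every prime `q` away from the additive places of
residue characteristic `2`, granted Carayol's conductor theorem** (the named fact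
`Carayol1986_artinConductorExponent`, Carayol 1986 Thm. (A) / Darmon–Diamond–Taylor Thm. 3.1 (d)):
choose `ℓ > q` with `V_ℓ W` irreducible (`exists_prime_gt_isIrreducible_rationalGaloisRepTate`), apply
L0a and read `a_w(V_ℓ W) = f_w(W)` by Ogg's formula in Galois form
(`conductorExponentOf_geomPoints_eq_conductorExponent_of_ringChar_two_imp`).
[cite: CarayolASENS1986, Thm. (A), (0.8) Corollaire (pp. 410–411)]
[cite: DarmonDiamondTaylor1995, Thm. 3.1 (d) with §2.1 (p. 54)] [cite: SilvermanATAEC1994, Thm. IV.10.2, IV.11.1] -/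
theorem padicValNat_level_eq_conductorExponent_of_carayol1986_of_packet
    (hC : Carayol1986_artinConductorExponent) (hf₀ : IsNewform0 f₀)
    (hgood : ∀ v : HeightOneSpectrum (𝓞 ℚ), ¬ ((primesEquiv v : ℕ) ∣ N) → W.HasGoodReductionAt v)
    (hap : ∀ p : ℕ, p.Prime → ¬ p ∣ N → cuspCoeff f₀ p = (W.LFunction p : ℂ))
    {q : ℕ} (hq : q.Prime) (w : HeightOneSpectrum (𝓞 ℚ)) (hqw : (q : 𝓞 ℚ) ∈ w.asIdeal)
    (h2 : ringChar (𝓞 ℚ ⧸ w.asIdeal) = 2 → ¬ W.HasAdditiveReductionAt w) :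
    padicValNat q N = W.conductorExponent w := by
  obtain ⟨ℓ, hℓ, hqℓ, hirr⟩ := W.exists_prime_gt_isIrreducible_rationalGaloisRepTate q
  haveI := hℓ
  obtain ⟨ι⟩ := PadicAlgCl.nonempty_ringEquiv_complex ℓ
  obtain ⟨ρ, hρ, hirrρ, hcond⟩ :=
    exists_isGaloisRepOfNewform1_rationalTate_of_packet W f₀ hf₀ hgood hap ℓ ι hirr
  have hnew : IsNewform1 (liftToGamma1 N 2 f₀) := (isNewform1_liftToGamma1_iff_holds N 2 f₀).mpr hf₀
  have hqw' : natGenerator w = q :=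
    (Nat.prime_dvd_prime_iff_eq (primesEquiv w).2 hq).mp ((Rat.natCast_mem_asIdeal_iff w).mp hqw)
  have hℓw : (ℓ : 𝓞 ℚ) ∉ w.asIdeal := by
    rw [Rat.natCast_mem_asIdeal_iff, hqw']
    intro h
    exact (ne_of_lt hqℓ) ((Nat.prime_dvd_prime_iff_eq hq hℓ.out).mp h)
  have key := hC (liftToGamma1 N 2 f₀) le_rfl hnew ℓ ι ρ hρ hirrρ q hq (ne_of_lt hqℓ) w hqw
  rw [← key, hcond w hℓw]
  exact W.conductorExponentOf_geomPoints_eq_conductorExponent_of_ringChar_two_imp ℓ _ w hℓw h2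

omit [NeZero N] in
/-- `N = N_W` exponentwise (copy of the tree's private
`eq_conductorNorm_of_forall_padicValNat_eq_conductorExponent`). [folklore] -/
theorem eq_conductorNorm_of_forall_padicValNat_eq_conductorExponent' (hN : N ≠ 0)
    (h : ∀ q : ℕ, q.Prime → ∀ w : HeightOneSpectrum (𝓞 ℚ), (q : 𝓞 ℚ) ∈ w.asIdeal →
      padicValNat q N = W.conductorExponent w) :
    N = W.conductorNorm ℤ := by
  refine Nat.eq_of_factorization_eq hN (W.conductorNorm_pos_holds).ne' fun q ↦ ?_
  by_cases hq : q.Prime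
  · set q' : Nat.Primes := ⟨q, hq⟩ with hq'
    set w : HeightOneSpectrum (𝓞 ℚ) := (primesEquiv (R := 𝓞 ℚ)).symm q' with hw
    have hpw : (primesEquiv w : Nat.Primes) = q' := Equiv.apply_symm_apply _ _
    have hqw : (q : 𝓞 ℚ) ∈ w.asIdeal :=
      (Rat.natCast_mem_asIdeal_iff w).mpr (by rw [show natGenerator w = q from congrArg Subtype.val hpw])
    have hgen : natGenerator ((primesEquiv (R := ℤ)).symm q') = q :=
      congrArg (fun x : Nat.Primes ↦ (x : ℕ)) (Equiv.apply_symm_apply (primesEquiv (R := ℤ)) q')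
    rw [Nat.factorization_def _ hq, h q hq w hqw, W.conductorExponent_ringOfIntegers_eq w,
      ← W.factorization_conductorNorm_holds ((primesEquiv (R := ℤ)).symm (primesEquiv w)), hpw, hgen]
  · rw [Nat.factorization_eq_zero_of_not_prime _ hq, Nat.factorization_eq_zero_of_not_prime _ hq]

/-- **L0c — level `=` conductor for the PACKET, for a curve not additive at `2`, modulo Carayol (A)
alone.** [cite: CarayolASENS1986, Thm. (A), (0.8) Corollaire] [cite: DarmonDiamondTaylor1995, Thm. 3.1 (d)] -/
theorem level_eq_conductorNorm_of_carayol1986_of_packet_of_not_additive_two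
    (hC : Carayol1986_artinConductorExponent) (hf₀ : IsNewform0 f₀)
    (hgood : ∀ v : HeightOneSpectrum (𝓞 ℚ), ¬ ((primesEquiv v : ℕ) ∣ N) → W.HasGoodReductionAt v)
    (hap : ∀ p : ℕ, p.Prime → ¬ p ∣ N → cuspCoeff f₀ p = (W.LFunction p : ℂ))
    (h2 : ∀ w : HeightOneSpectrum (𝓞 ℚ), ringChar (𝓞 ℚ ⧸ w.asIdeal) = 2 →
      ¬ W.HasAdditiveReductionAt w) :
    N = W.conductorNorm ℤ :=
  eq_conductorNorm_of_forall_padicValNat_eq_conductorExponent' W (NeZero.ne N) fun _ hq w hqw ↦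
    padicValNat_level_eq_conductorExponent_of_carayol1986_of_packet W f₀ hC hf₀ hgood hap hq w hqw (h2 w)

/-- **L0c' — level `=` conductor for the PACKET, for EVERY elliptic `W/ℚ`, modulo Carayol (A) and
Saito's `p = 2` leaf of Ogg's formula for `W`** (the named fact
`W.swanConductorAt_rationalTate_eq_wildConductorExponent_of_ringChar_eq_two ℓ`, Saito 1988; for `W`
with `ord₂ j ≤ 0` a theorem of the tree, in general gen-4 k3's residual `SaitoTwoSupersingular`).
[cite: CarayolASENS1986, Thm. (A), (0.8) Corollaire] [cite: Saito1988, Theorem 1]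
[cite: DiamondShurman2005, Thm. 8.8.1] -/
theorem level_eq_conductorNorm_of_carayol1986_of_saito_of_packet
    (hC : Carayol1986_artinConductorExponent)
    (hS : ∀ (ℓ : ℕ) [Fact ℓ.Prime],
      W.swanConductorAt_rationalTate_eq_wildConductorExponent_of_ringChar_eq_two ℓ)
    (hf₀ : IsNewform0 f₀)
    (hgood : ∀ v : HeightOneSpectrum (𝓞 ℚ), ¬ ((primesEquiv v : ℕ) ∣ N) → W.HasGoodReductionAt v)
    (hap : ∀ p : ℕ, p.Prime → ¬ p ∣ N → cuspCoeff f₀ p = (W.LFunction p : ℂ)) :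
    N = W.conductorNorm ℤ := by
  refine eq_conductorNorm_of_forall_padicValNat_eq_conductorExponent' W (NeZero.ne N)
    fun q hq w hqw ↦ ?_
  obtain ⟨ℓ, hℓ, hqℓ, hirr⟩ := W.exists_prime_gt_isIrreducible_rationalGaloisRepTate q
  haveI := hℓ
  obtain ⟨ι⟩ := PadicAlgCl.nonempty_ringEquiv_complex ℓ
  obtain ⟨ρ, hρ, hirrρ, hcond⟩ :=
    exists_isGaloisRepOfNewform1_rationalTate_of_packet W f₀ hf₀ hgood hap ℓ ι hirr
  have hnew : IsNewform1 (liftToGamma1 N 2 f₀) := (isNewform1_liftToGamma1_iff_holds N 2 f₀).mpr hf₀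
  have hqw' : natGenerator w = q :=
    (Nat.prime_dvd_prime_iff_eq (primesEquiv w).2 hq).mp ((Rat.natCast_mem_asIdeal_iff w).mp hqw)
  have hℓw : (ℓ : 𝓞 ℚ) ∉ w.asIdeal := by
    rw [Rat.natCast_mem_asIdeal_iff, hqw']
    intro h
    exact (ne_of_lt hqℓ) ((Nat.prime_dvd_prime_iff_eq hq hℓ.out).mp h)
  have key := hC (liftToGamma1 N 2 f₀) le_rfl hnew ℓ ι ρ hρ hirrρ q hq (ne_of_lt hqℓ) w hqw
  rw [← key, hcond w hℓw]
  exact W.artinConductorExponent_tate_eq_conductorExponent_of_isElliptic_of_two ℓ (hS ℓ) _ w hℓw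

end LevelLeaf

/-! ## L1 — the elementary assembly: packet + `N = N_W` + the sign at `p ∥ N` ⇒ `IsNewformOf` -/

section Assembly

variable (W : WeierstrassCurve ℚ) [W.IsElliptic] {N : ℕ} [NeZero N] (f₀ : CuspForm (Gamma0 N) 2)

/-- **L1 — EXTREMAL SPLIT (elementary).**  For an elliptic `W/ℚ` and a newform `f₀ ∈ S₂(Γ₀(N))` at
level `N = N_W` with `a_p(f₀) = a_p(W)` at every prime `p ∤ N` AND at every prime `p ∥ N`, one has
`aₙ(f₀) = aₙ(W)` for all `n` (`IsNewformOf W f₀`): at `p² ∣ N` both sides vanish (`a_p(f₀) = 0`,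
Atkin–Lehner Thm. 3, `IsNewform0.cuspCoeff_eq_zero_of_sq_dvd`; `p² ∣ N_W ⇔` additive reduction,
Silverman ATAEC IV.10.2 (c), `two_le_conductorExponent_iff_holds`, and `a_p(W) = 0` there,
`LFunction_apply_eq_zero_of_hasAdditiveReductionAt`), and the two multiplicative sequences with equal
prime values and the same prime-power recursions coincide (`isNewformOf_of_forall_prime_cuspCoeff_eq`,
Diamond–Shurman (8.43)–(8.44)).  So the minimal `n` with `aₙ(f₀) ≠ aₙ(W)` is a prime `p ∥ N`, where
both values are signs.  [cite: AtkinLehner1970, Thm. 3] [cite: DiamondShurman2005, §8.8 (8.43)–(8.44), Thm. 8.8.3]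
[cite: SilvermanATAEC1994, Thm. IV.10.2] -/
theorem isNewformOf_of_packet_of_level_eq_of_sign (hf₀ : IsNewform0 f₀) (hN : N = W.conductorNorm ℤ)
    (hap : ∀ p : ℕ, p.Prime → ¬ p ∣ N → cuspCoeff f₀ p = (W.LFunction p : ℂ))
    (hsign : ∀ p : ℕ, p.Prime → p ∣ N → ¬ p ^ 2 ∣ N → cuspCoeff f₀ p = (W.LFunction p : ℂ)) :
    IsNewformOf W f₀ := by
  subst hN
  refine isNewformOf_of_forall_prime_cuspCoeff_eq (fun u ↦ conductorExponent_eq_zero_iff_holds u W)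
    hf₀ fun p hp ↦ ?_
  by_cases hpN : p ∣ W.conductorNorm ℤ
  · by_cases hp2 : p ^ 2 ∣ W.conductorNorm ℤ
    · -- additive prime: `a_p(f₀) = 0 = a_p(W)`
      rw [hf₀.cuspCoeff_eq_zero_of_sq_dvd hp hp2]
      haveI : Fact p.Prime := ⟨hp⟩
      set w : HeightOneSpectrum (𝓞 ℚ) := (primesEquiv (R := 𝓞 ℚ)).symm ⟨p, hp⟩ with hw
      have hpw : (primesEquiv w : Nat.Primes) = ⟨p, hp⟩ := Equiv.apply_symm_apply _ _
      have hgen : natGenerator ((primesEquiv (R := ℤ)).symm (primesEquiv w)) = p := by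
        rw [hpw]
        exact congrArg (fun x : Nat.Primes ↦ (x : ℕ))
          (Equiv.apply_symm_apply (primesEquiv (R := ℤ)) ⟨p, hp⟩)
      have h2f : 2 ≤ W.conductorExponent w := by
        have h1 : 2 ≤ (W.conductorNorm ℤ).factorization p :=
          (hp.pow_dvd_iff_le_factorization (NeZero.ne _)).mp hp2
        rw [W.conductorExponent_ringOfIntegers_eq w,
          ← W.factorization_conductorNorm_holds ((primesEquiv (R := ℤ)).symm (primesEquiv w)), hgen]
        exact h1
      have hadd : W.HasAdditiveReductionAt w := (two_le_conductorExponent_iff_holds w W).mp h2f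
      have hv : ((primesEquiv w : Nat.Primes) : ℕ) = p := by rw [hpw]
      rw [W.LFunction_apply_eq_zero_of_hasAdditiveReductionAt hv hadd (dvd_refl p), Int.cast_zero]
    · exact hsign p hp hpN hp2
  · exact hap p hp hpN

end Assembly

/-! ## L2 — the residual: the Steinberg sign bit at `p ∥ N` -/

/-- **L2 — `SteinbergSignPacket` (the ONLY Euler-factor datum S9 needs).**  For every elliptic `W/ℚ`
and every newform `f₀ ∈ S₂(Γ₀(N))` at level `N = N_W` carrying `a_p(W)` for `p ∤ N` with `W` good off
`N`: `a_p(f₀) = a_p(W)` at every prime `p ∥ N` — i.e. the Atkin–Lehner sign `-λ_p(f₀)` equals `+1` at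
split and `-1` at non-split multiplicative reduction.  In print: Darmon–Diamond–Taylor Thm. 3.1 (e),
first case ("`p ∥ N`, `p ∤ cond ψ`: `ρ|_{G_p} ~ (χε, *; 0, χ)`, `χ` unramified, `χ(Frob_p) = a_p`";
Deligne–Rapoport / Langlands / Carayol), read on `ρ = V_ℓ W`, whose unramified quotient at a
multiplicative `p` is the twist `δ` of the Tate curve with `δ(Frob_p) = a_p(W)`.  Invisible to
conductors (`a(V ⊗ ψ)` at `p` does not see `δ`), to quadratic twists and to the functional equation.
Implied by `Carayol1986_eulerFactor` (L2a).  On the Frey family `E_{a,b} : y² = x(x-a)(x+b)`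
(`a, b` coprime) at an odd `q ∣ ab(a+b)`: `a_q(E) = (b/q), (-a/q), (a/q)` for `q ∣ a`, `q ∣ b`,
`q ∣ a+b` (tangent-cone discriminants; kit job j344703: 11756 triples `|a|,|b| ≤ 40`, 0 mismatches, `v_q(N) = 1` throughout).
[cite: DarmonDiamondTaylor1995, Thm. 3.1 (e) (p. 86) and p. 87] [cite: CarayolASENS1986, Thm. (A)]
[cite: Knapp1993, Thm. 9.27] -/
def SteinbergSignPacket : Prop :=
  ∀ (W : WeierstrassCurve ℚ) [W.IsElliptic] {N : ℕ} [NeZero N] (f₀ : CuspForm (Gamma0 N) 2),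
    IsNewform0 f₀ → N = W.conductorNorm ℤ →
    (∀ v : HeightOneSpectrum (𝓞 ℚ), ¬ ((primesEquiv v : ℕ) ∣ N) → W.HasGoodReductionAt v) →
    (∀ p : ℕ, p.Prime → ¬ p ∣ N → cuspCoeff f₀ p = (W.LFunction p : ℂ)) →
    ∀ p : ℕ, p.Prime → p ∣ N → ¬ p ^ 2 ∣ N → cuspCoeff f₀ p = (W.LFunction p : ℂ)

/-! ## Closers (kernel-checked glue) -/

section Closers

/-- **M3 recut: the packet IS the newform of `W`, and its level is `N_W`** — from Carayol (A), Saito's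
leaf for `W`, and the Steinberg sign bit (no `Carayol1986_eulerFactor`, no Eichler–Shimura).
[cite: CarayolASENS1986, Thm. (A), (0.8) Corollaire] [cite: DarmonDiamondTaylor1995, Thm. 3.1 (d), (e)] -/
theorem isNewformOf_of_packet_of_carayol1986_of_saito_of_sign (hC : Carayol1986_artinConductorExponent)
    (hSign : SteinbergSignPacket) (W : WeierstrassCurve ℚ) [W.IsElliptic] [NeZero (W.conductorNorm ℤ)]
    (hS : ∀ (ℓ : ℕ) [Fact ℓ.Prime],
      W.swanConductorAt_rationalTate_eq_wildConductorExponent_of_ringChar_eq_two ℓ)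
    {N : ℕ} [NeZero N] (f₀ : CuspForm (Gamma0 N) 2) (hf₀ : IsNewform0 f₀)
    (hgood : ∀ v : HeightOneSpectrum (𝓞 ℚ), ¬ ((primesEquiv v : ℕ) ∣ N) → W.HasGoodReductionAt v)
    (hap : ∀ p : ℕ, p.Prime → ¬ p ∣ N → cuspCoeff f₀ p = (W.LFunction p : ℂ)) :
    IsNewformOf W f₀ ∧ N = W.conductorNorm ℤ := by
  have hN : N = W.conductorNorm ℤ :=
    level_eq_conductorNorm_of_carayol1986_of_saito_of_packet W f₀ hC hS hf₀ hgood hap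
  exact ⟨isNewformOf_of_packet_of_level_eq_of_sign W f₀ hf₀ hN hap
    (hSign W f₀ hf₀ hN hgood hap), hN⟩

/-- **(packet) ⇒ (2) `BCDT.IsModular W`** from {C_A, Saito leaf of `W`, SteinbergSignPacket}. Replaces
`isNewformOf_of_packet_off_level_of_carayolEuler hCE` + `hC` in k2 gen-4's
`isModular_of_isModularGaloisRepTate_two_primes` / `sigThreeImpTwoFreyCS_of_carayolEuler_of_freyLevel`.
[cite: BCDTJAMS2001, Introduction ((3) ⇒ (2))] -/
theorem isModular_of_packet_of_carayol1986_of_saito_of_sign (hC : Carayol1986_artinConductorExponent)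
    (hSign : SteinbergSignPacket) (W : WeierstrassCurve ℚ) [W.IsElliptic] [NeZero (W.conductorNorm ℤ)]
    (hS : ∀ (ℓ : ℕ) [Fact ℓ.Prime],
      W.swanConductorAt_rationalTate_eq_wildConductorExponent_of_ringChar_eq_two ℓ)
    {N : ℕ} [NeZero N] (f₀ : CuspForm (Gamma0 N) 2) (hf₀ : IsNewform0 f₀)
    (hgood : ∀ v : HeightOneSpectrum (𝓞 ℚ), ¬ ((primesEquiv v : ℕ) ∣ N) → W.HasGoodReductionAt v)
    (hap : ∀ p : ℕ, p.Prime → ¬ p ∣ N → cuspCoeff f₀ p = (W.LFunction p : ℂ)) :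
    BCDT.IsModular W := by
  obtain ⟨hWf, hN⟩ :=
    isNewformOf_of_packet_of_carayol1986_of_saito_of_sign hC hSign W hS f₀ hf₀ hgood hap
  subst hN
  exact ⟨f₀, hWf⟩

/-- **The realisation leaf in packet shape** (`hPk`): a modular `ρ_{W,ℓ}` yields the a.e. packet OFF ITS
LEVEL (hole at `ℓ` filled).  k2 gen 4 PROVES it under the compatible-system cut from two primes
(`exists_isNewform0_packet_off_level_of_two_primes`); k1 reduces the single-prime version to
Eichler–Shimura-weak / CR + hole-filler. [cite: BCDTJAMS2001, Introduction ((3) ⇒ (2))] -/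
def SomeLevelPacket : Prop :=
  ∀ (W : WeierstrassCurve ℚ) [W.IsElliptic] (ℓ : ℕ) [Fact ℓ.Prime], W.IsModularGaloisRepTate ℓ →
    ∃ (N : ℕ) (_ : NeZero N) (f₀ : CuspForm (Gamma0 N) 2), IsNewform0 f₀ ∧
      (∀ v : HeightOneSpectrum (𝓞 ℚ), ¬ ((primesEquiv v : ℕ) ∣ N) → W.HasGoodReductionAt v) ∧
      ∀ p : ℕ, p.Prime → ¬ p ∣ N → cuspCoeff f₀ p = (W.LFunction p : ℂ)

/-- **Plan closer — the VERBATIM stub `stub_threeImpTwo` from the four leaves**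
{`SomeLevelPacket`, Carayol (A), Saito's `p = 2` leaf (all curves; ⇐ gen-4 k3's `SaitoTwoSupersingular`
by `saito_two_of_saitoTwoSupersingular`), `SteinbergSignPacket`}.
[cite: BCDTJAMS2001, Introduction ((3) ⇒ (2))] [cite: CarayolASENS1986, Thm. (A)] -/
theorem stub_threeImpTwo_of_packet_leaves (hPk : SomeLevelPacket)
    (hC : Carayol1986_artinConductorExponent)
    (hS : ∀ (V : WeierstrassCurve ℚ) (ℓ : ℕ) [Fact ℓ.Prime],
      V.swanConductorAt_rationalTate_eq_wildConductorExponent_of_ringChar_eq_two ℓ)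
    (hSign : SteinbergSignPacket) :
    ∀ (W : WeierstrassCurve ℚ) [W.IsElliptic] [NeZero (W.conductorNorm ℤ)] (ℓ : ℕ) [Fact ℓ.Prime],
      W.IsModularGaloisRepTate ℓ → BCDT.IsModular W := by
  intro W _ _ ℓ _ h
  obtain ⟨N, hN, f₀, hf₀, hgood, hap⟩ := hPk W ℓ h
  exact isModular_of_packet_of_carayol1986_of_saito_of_sign hC hSign W (hS W) f₀ hf₀ hgood hap

end Closers


/-! ## G6a — the Steinberg corner of Carayol's theorem on `Γ₀(N)` (the smallest literature target) -/

/-- **G6a — `CarayolSteinbergGamma0`.**  For every newform `f₀ ∈ S₂(Γ₀(N))`, every prime `p`, every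
`ι : ℚ̄_p ≃ ℂ`, every irreducible `ρ : Γ_ℚ → GL₂(ℚ̄_p)` attached to the `Γ₁(N)`-lift of `f₀` away from
`Np`, every prime `ℓ ≠ p` with `ℓ ∥ N`, every prime `𝔔 ∣ ℓ` of `ℤ̄` and every arithmetic Frobenius
`σ ∈ D_𝔔`: the reversed characteristic polynomial of `σ` on the inertia coinvariants of `ρ` at `𝔔` is
`1 - ι⁻¹(a_ℓ(f₀)) X` — the local component at `ℓ ∥ N` (trivial character) is special
`St ⊗ χ`, `χ` unramified quadratic or trivial, `ρ|_{G_ℓ} ~ (χε, *; 0, χ)` with `χ(Frob_ℓ) = a_ℓ(f₀) = -w_ℓ`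
(Darmon–Diamond–Taylor Thm. 3.1 (e), first case; due to Deligne–Rapoport's model of `X₀(N)` at `p ∥ N`,
Langlands 1973 §7, Carayol 1986 Thm. (A)).  The restriction of `Carayol1986_eulerFactor` to
(`k = 2`, `Γ₀`, `ℓ ∥ N`); the ONLY Euler-factor input S9 needs (G6b/G6c).
[cite: DarmonDiamondTaylor1995, Thm. 3.1 (e) (p. 86) and p. 87] [cite: CarayolASENS1986, Thm. (A)]
[cite: DeligneRapoport1973, VII §5] [cite: Rohrlich1997, §3.8 Thm. 5] -/
def CarayolSteinbergGamma0 : Prop :=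
  ∀ {N : ℕ} [NeZero N] (f₀ : CuspForm (Gamma0 N) 2), IsNewform0 f₀ →
    ∀ (p : ℕ) [Fact p.Prime] (ι : PadicAlgCl p ≃+* ℂ) (ρ : FramedGaloisRep ℚ (PadicAlgCl p) 2),
      IsGaloisRepOfNewform1 (liftToGamma1 N 2 f₀)
        ((ι.symm : ℂ →+* PadicAlgCl p).comp (algebraMap (coeffCharField (liftToGamma1 N 2 f₀)) ℂ))
          {q | q ∣ N * p} ρ →
      ρ.toGaloisRep.IsIrreducible →
    ∀ ℓ : ℕ, ℓ.Prime → ℓ ≠ p → ℓ ∣ N → ¬ ℓ ^ 2 ∣ N →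
    ∀ w : HeightOneSpectrum (𝓞 ℚ), (ℓ : 𝓞 ℚ) ∈ w.asIdeal → ∀ 𝔔 ∈ w.primesAbove,
    ∀ σ : 𝔔.decompositionSubgroup (absoluteGaloisGroup ℚ),
      IsArithFrobAt (𝓞 ℚ) (σ : absoluteGaloisGroup ℚ) 𝔔 →
      (ρ.toGaloisRep.toInertiaCoinvariants 𝔔 σ).charpoly.reverse =
        1 - C (ι.symm (cuspCoeff f₀ ℓ)) * X

/-- **C_E ⇒ G6a**: specialise Carayol's Euler-factor theorem to the lift of `f₀` (a `Γ₁(N)`-newform,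
`isNewform1_liftToGamma1_iff_holds`; same `q`-expansion, `coe_liftToGamma1_holds`; trivial nebentypus,
`nebentypus_liftToGamma1_holds`, whose value at the non-unit `ℓ ∣ N` is `0`). [cite: CarayolASENS1986, Thm. (A)]
[cite: DiamondShurman2005, §4.3 (S_k(Γ₀(N)) = S_k(N, 𝟙))] -/
theorem carayolSteinbergGamma0_of_carayol1986_eulerFactor (hCE : Carayol1986_eulerFactor) :
    CarayolSteinbergGamma0 := by
  intro N _ f₀ hf₀ p _ ι ρ hρ hirr ℓ hℓ hℓp hℓN _ w hℓw 𝔔 h𝔔 σ hσ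
  have hne : f₀ ≠ 0 := ne_zero_of_isNewform0 f₀ hf₀
  have hnew : IsNewform1 (liftToGamma1 N 2 f₀) :=
    (isNewform1_liftToGamma1_iff_holds (N := N) (k := 2) f₀).mpr hf₀
  have h1 := hCE (liftToGamma1 N 2 f₀) le_rfl hnew p ι ρ hρ hirr ℓ hℓ hℓp w hℓw 𝔔 h𝔔 σ hσ
  have hcc : cuspCoeff (liftToGamma1 N 2 f₀) ℓ = cuspCoeff f₀ ℓ := by
    rw [cuspCoeff, cuspCoeff, coe_liftToGamma1_holds N 2 f₀]
  have hε : nebentypus (liftToGamma1 N 2 f₀) (ℓ : ZMod N) = 0 := by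
    rw [nebentypus_liftToGamma1_holds N 2 hne]
    exact MulChar.map_nonunit _ (mt (ZMod.isUnit_prime_iff_not_dvd hℓ).mp (not_not.mpr hℓN))
  rw [h1, hcc, hε]
  simp

/-! ## G6b — the transport: G6a ⇒ the Steinberg sign of the packet -/

section Transport

variable (W : WeierstrassCurve ℚ) [W.IsElliptic] {N : ℕ} [NeZero N] (f₀ : CuspForm (Gamma0 N) 2)

/-- **L0a′ — L0a with the frame exposed.**  For the packet newform `f₀` of `W` and a frame
`eV : ℚ_ℓ² ≅ V_ℓ W` with its good-reduction Frobenius data (`exists_framedGaloisRep_rationalTate`), the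
base change `VQ ⊗ ℚ̄_ℓ` ITSELF is attached to `liftToGamma1 N 2 f₀` away from `N ℓ` and is irreducible
(`V_ℓ W` irreducible and odd ⇒ absolutely irreducible).  Same proof as L0a.
[cite: DarmonDiamondTaylor1995, Thm. 3.1 (b), (c)] [cite: SilvermanAEC2009, C.21 Remark 21.3] -/
theorem isGaloisRepOfNewform1_baseChange_of_packet (hf₀ : IsNewform0 f₀)
    (hgood : ∀ v : HeightOneSpectrum (𝓞 ℚ), ¬ ((primesEquiv v : ℕ) ∣ N) → W.HasGoodReductionAt v)
    (hap : ∀ p : ℕ, p.Prime → ¬ p ∣ N → cuspCoeff f₀ p = (W.LFunction p : ℂ))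
    (ℓ : ℕ) [Fact ℓ.Prime] (ι : PadicAlgCl ℓ ≃+* ℂ)
    (hirr : (W.rationalGaloisRepTate ℓ).IsIrreducible)
    (VQ : FramedGaloisRep ℚ ℚ_[ℓ] 2) (eV : (Fin 2 → ℚ_[ℓ]) ≃ₗ[ℚ_[ℓ]] W.rationalTateModule ℓ)
    (heV : ∀ (σ : absoluteGaloisGroup ℚ) (x : Fin 2 → ℚ_[ℓ]),
      eV (FramedRep.toRepresentation VQ σ x) = W.rationalGaloisRepTate ℓ σ (eV x))
    (hV : ∀ v : HeightOneSpectrum (𝓞 ℚ), (ℓ : 𝓞 ℚ) ∉ v.asIdeal → W.HasGoodReductionAt v →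
      FramedGaloisRep.IsUnramifiedAt v VQ ∧
        FramedGaloisRep.HasFrobCharpolyAt v
          (X ^ 2 - C ((W.LFunction (primesEquiv v : ℕ) : ℤ) : ℚ_[ℓ]) * X +
            C ((primesEquiv v : ℕ) : ℚ_[ℓ])) VQ) :
    IsGaloisRepOfNewform1 (liftToGamma1 N 2 f₀)
        ((ι.symm : ℂ →+* PadicAlgCl ℓ).comp (algebraMap (coeffCharField (liftToGamma1 N 2 f₀)) ℂ))
        {q | q ∣ N * ℓ}
        (VQ.baseChange (algebraMap ℚ_[ℓ] (PadicAlgCl ℓ)) (continuous_algebraMap_padicAlgCl ℓ)) ∧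
      (FramedGaloisRep.toGaloisRep (VQ.baseChange (algebraMap ℚ_[ℓ] (PadicAlgCl ℓ))
          (continuous_algebraMap_padicAlgCl ℓ))).IsIrreducible := by
  classical
  have hℓp : ℓ.Prime := Fact.out
  have hne : f₀ ≠ 0 := ne_zero_of_isNewform0 f₀ hf₀
  set iE := algebraMap ℚ_[ℓ] (PadicAlgCl ℓ) with hiE
  have hiEc : Continuous iE := continuous_algebraMap_padicAlgCl ℓ
  refine ⟨?_, ?_⟩
  · -- attached to the lift of `f₀` away from `N ℓ`
    intro v hvS
    set q : ℕ := ((primesEquiv v : Nat.Primes) : ℕ) with hqdef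
    have hq : q.Prime := (primesEquiv v).2
    simp only [Set.mem_setOf_eq] at hvS
    have hqN : ¬ q ∣ N := fun h ↦ hvS (h.trans (dvd_mul_right N ℓ))
    have hqℓ : q ≠ ℓ := fun h ↦ hvS (h ▸ dvd_mul_left q N)
    have hℓv : (ℓ : 𝓞 ℚ) ∉ v.asIdeal := by
      rw [Rat.natCast_mem_asIdeal_iff]
      intro h
      exact hqℓ ((Nat.prime_dvd_prime_iff_eq hq hℓp).mp h)
    have hgoodv : W.HasGoodReductionAt v := hgood v hqN
    obtain ⟨hVu, hVf⟩ := hV v hℓv hgoodv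
    refine ⟨(FramedGaloisRep.isUnramifiedAt_baseChange_iff iE hiEc iE.injective v VQ).mpr hVu, ?_⟩
    rw [map_heckePolynomial_liftToGamma1_of_cuspCoeff_eq W f₀ hne ℓ ι hq hqN (hap q hq hqN)]
    have hVf' := FramedGaloisRep.hasFrobCharpolyAt_baseChange iE hiEc hVf
    have hmapQ : (X ^ 2 - C ((W.LFunction q : ℤ) : ℚ_[ℓ]) * X + C (q : ℚ_[ℓ]) : ℚ_[ℓ][X]).map iE =
        X ^ 2 - C ((W.LFunction q : ℤ) : PadicAlgCl ℓ) * X + C (q : PadicAlgCl ℓ) := by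
      simp
    rw [hmapQ] at hVf'
    exact hVf'
  · -- irreducible: `V_ℓ W` is odd and irreducible, hence absolutely irreducible
    have hirrQ : FramedRep.IsIrreducible VQ :=
      (Representation.isIrreducible_iff_of_equivariant VQ.toRepresentation (W.rationalGaloisRepTate ℓ)
        (MonoidHom.id _) Function.surjective_id eV heV).mpr hirr
    obtain ⟨c, hc⟩ := exists_isComplexConjugation (Rat.castHom ℝ)
    have hcc : c * c = 1 := by rw [← pow_two]; exact hc.sq_eq_one
    have hdet : Matrix.GeneralLinearGroup.det (VQ c) = -1 := by
      apply Units.ext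
      rw [Matrix.GeneralLinearGroup.val_det_apply, Units.val_neg, Units.val_one]
      have h1 : ((VQ c : GL (Fin 2) ℚ_[ℓ]) : Matrix (Fin 2) (Fin 2) ℚ_[ℓ]).det =
          LinearMap.det (VQ.toRepresentation c) := by
        rw [← LinearMap.det_toLin']
        rfl
      have h2 : LinearMap.det (VQ.toRepresentation c) =
          LinearMap.det (W.rationalGaloisRepTate ℓ c) := by
        have hconj : (W.rationalGaloisRepTate ℓ c : W.rationalTateModule ℓ →ₗ[ℚ_[ℓ]] _) =
            (eV : (Fin 2 → ℚ_[ℓ]) →ₗ[ℚ_[ℓ]] W.rationalTateModule ℓ) ∘ₗ VQ.toRepresentation c ∘ₗ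
              (eV.symm : W.rationalTateModule ℓ →ₗ[ℚ_[ℓ]] (Fin 2 → ℚ_[ℓ])) := by
          apply LinearMap.ext
          intro y
          simp only [LinearMap.coe_comp, LinearEquiv.coe_coe, Function.comp_apply]
          rw [heV, LinearEquiv.apply_symm_apply]
        rw [hconj, LinearMap.det_conj]
      rw [h1, h2, Literature.AlgebraicGeometry.Motives.det_rationalGaloisRepTate_eq_cyclotomicCharacter
        W ℓ c, GaloisRep.cyclotomicCharacter_of_isComplexConjugation ℓ hc, map_neg, map_one]
    have habs : FramedRep.IsAbsolutelyIrreducible VQ :=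
      FramedRep.isAbsolutelyIrreducible_of_isIrreducible_of_det_eq_neg_one VQ hirrQ two_ne_zero hcc
        hdet
    exact habs (PadicAlgCl ℓ) iE

omit [W.IsElliptic] [NeZero N] in
/-- The `X`-coefficient of `1 - a X` is `-a`. [folklore] -/
theorem coeff_lin_one {S : Type*} [CommRing S] (a : S) : (1 - C a * X : S[X]).coeff 1 = -a := by
  simp [Polynomial.coeff_one, Polynomial.coeff_C, Polynomial.coeff_X]

omit [W.IsElliptic] [NeZero N] in
/-- The `X`-coefficient of `1 - a X + b X²` is `-a`. [folklore] -/
theorem coeff_quad_one {S : Type*} [CommRing S] (a b : S) :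
    (1 - C a * X + C b * X ^ 2 : S[X]).coeff 1 = -a := by
  simp [Polynomial.coeff_one, Polynomial.coeff_X_pow, Polynomial.coeff_C, Polynomial.coeff_X]

/-- **G6b — the Steinberg sign of the packet from G6a.**  For an elliptic `W/ℚ`, a newform
`f₀ ∈ S₂(Γ₀(N))` with `W` good off `N` and `a_q(f₀) = a_q(W)` for `q ∤ N`, and a prime `p ∥ N`:
`a_p(f₀) = a_p(W)`.  Proof: choose `ℓ > p` with `V_ℓ W` irreducible
(`exists_prime_gt_isIrreducible_rationalGaloisRepTate`), a frame `VQ ≅ V_ℓ W`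
(`exists_framedGaloisRep_rationalTate`); by L0a′ `VQ ⊗ ℚ̄_ℓ` is an irreducible representation attached to
the lift of `f₀`, so G6a gives `det(1 - σT | (VQ ⊗ ℚ̄_ℓ)_{I_𝔔}) = 1 - a_p(f₀) T` at `𝔔 ∣ p`; coinvariants
commute with base change (`charpoly_toCoinvariants_map`) and conjugation
(`ContinuousRep.inertiaCoinvariantsCongr_conj_toInertiaCoinvariants`), and on `V_ℓ W` the same
determinant is `L_p(W, T)` (`reverse_charpoly_toInertiaCoinvariants_eq_localPolynomialAt'`, all
reduction types); compare `T`-coefficients (`1 - a T + pT²`, `1 - T`, `1 + T`, `1` vs. `a_p(W)`,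
`1`, `-1`, `0`).  No level hypothesis `N = N_W` is used.
[cite: DarmonDiamondTaylor1995, Thm. 3.1 (e)] [cite: SilvermanAEC2009, §C.16 (PDF p. 390)] -/
theorem cuspCoeff_eq_lFunction_of_carayolSteinbergGamma0 (hCS : CarayolSteinbergGamma0)
    (hf₀ : IsNewform0 f₀)
    (hgood : ∀ v : HeightOneSpectrum (𝓞 ℚ), ¬ ((primesEquiv v : ℕ) ∣ N) → W.HasGoodReductionAt v)
    (hap : ∀ p : ℕ, p.Prime → ¬ p ∣ N → cuspCoeff f₀ p = (W.LFunction p : ℂ))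
    {p : ℕ} (hp : p.Prime) (hpN : p ∣ N) (hp2 : ¬ p ^ 2 ∣ N) :
    cuspCoeff f₀ p = (W.LFunction p : ℂ) := by
  classical
  -- the place `w ∣ p`, a prime `𝔔 ∣ w` of `ℤ̄` and an arithmetic Frobenius `σ ∈ D_𝔔`
  set w : HeightOneSpectrum (𝓞 ℚ) := (primesEquiv (R := 𝓞 ℚ)).symm ⟨p, hp⟩ with hw
  have hpw : (primesEquiv w : Nat.Primes) = ⟨p, hp⟩ := Equiv.apply_symm_apply _ _
  have hwp : ((primesEquiv w : Nat.Primes) : ℕ) = p := by rw [hpw]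
  have hgen : natGenerator w = p := by
    rw [show natGenerator w = ((primesEquiv w : Nat.Primes) : ℕ) from rfl, hwp]
  have hpw' : (p : 𝓞 ℚ) ∈ w.asIdeal := (Rat.natCast_mem_asIdeal_iff w).mpr (hgen ▸ dvd_refl p)
  obtain ⟨𝔔, h𝔔⟩ := w.primesAbove_nonempty
  haveI : 𝔔.IsPrime := h𝔔.1
  obtain ⟨σ₀, hσ₀⟩ :=
    IsDedekindDomain.HeightOneSpectrum.exists_isArithFrobAt_of_mem_primesAbove_holds (v := w) h𝔔
  set σ : 𝔔.decompositionSubgroup (absoluteGaloisGroup ℚ) := ⟨σ₀, hσ₀.mem_stabilizer⟩ with hσdef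
  have hσ : IsArithFrobAt (𝓞 ℚ) (σ : absoluteGaloisGroup ℚ) 𝔔 := hσ₀
  -- an auxiliary prime `ℓ > p` with `V_ℓ W` irreducible, `ι : ℚ̄_ℓ ≃ ℂ`, and a frame of `V_ℓ W`
  obtain ⟨ℓ, hℓ, hpℓ, hirr⟩ := W.exists_prime_gt_isIrreducible_rationalGaloisRepTate p
  haveI := hℓ
  obtain ⟨ι⟩ := PadicAlgCl.nonempty_ringEquiv_complex ℓ
  obtain ⟨VQ, eV, heV, hV⟩ := exists_framedGaloisRep_rationalTate W ℓ
  obtain ⟨hρ, hirrρ⟩ :=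
    isGaloisRepOfNewform1_baseChange_of_packet W f₀ hf₀ hgood hap ℓ ι hirr VQ eV heV hV
  have hℓw : (ℓ : 𝓞 ℚ) ∉ w.asIdeal := by
    rw [Rat.natCast_mem_asIdeal_iff, hgen]
    intro h
    exact (ne_of_lt hpℓ) ((Nat.prime_dvd_prime_iff_eq hp hℓ.out).mp h)
  -- (1) the Steinberg corner of Carayol's theorem for `VQ ⊗ ℚ̄_ℓ`, attached to the lift of `f₀`
  have h1 := hCS f₀ hf₀ ℓ ι _ hρ hirrρ p hp (ne_of_lt hpℓ) hpN hp2 w hpw' 𝔔 h𝔔 σ hσ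
  -- (2) coinvariants commute with the base change `ℚ_ℓ → ℚ̄_ℓ`
  haveI := W.module_finite_rationalTateModule_holds ℓ
  have hbc : ((FramedGaloisRep.toGaloisRep (VQ.baseChange (algebraMap ℚ_[ℓ] (PadicAlgCl ℓ))
      (continuous_algebraMap_padicAlgCl ℓ))).toInertiaCoinvariants 𝔔 σ).charpoly =
      (((FramedGaloisRep.toGaloisRep VQ).toInertiaCoinvariants 𝔔 σ).charpoly).map
        (algebraMap ℚ_[ℓ] (PadicAlgCl ℓ)) :=
    charpoly_toCoinvariants_map (algebraMap ℚ_[ℓ] (PadicAlgCl ℓ))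
      ((VQ : absoluteGaloisGroup ℚ →* GL (Fin 2) ℚ_[ℓ]).comp
        (𝔔.decompositionSubgroup (absoluteGaloisGroup ℚ)).subtype)
      (𝔔.inertia (𝔔.decompositionSubgroup (absoluteGaloisGroup ℚ))) σ
  have hrev : ∀ {P : ℚ_[ℓ][X]}, P.Monic →
      (P.map (algebraMap ℚ_[ℓ] (PadicAlgCl ℓ))).reverse =
        P.reverse.map (algebraMap ℚ_[ℓ] (PadicAlgCl ℓ)) := fun hP ↦ by
    rw [Polynomial.reverse, Polynomial.reverse, hP.natDegree_map, Polynomial.reflect_map]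
  rw [hbc, hrev (LinearMap.charpoly_monic _)] at h1
  -- (3) the frame `ℚ_ℓ² ≅ V_ℓ W` and the `E`-side Euler factor `L_w(W, T)`
  have hcW := W.continuous_rationalGaloisRepTate_holds ℓ
  have heV' : ∀ (γ : absoluteGaloisGroup ℚ) (x : Fin 2 → ℚ_[ℓ]),
      eV ((FramedGaloisRep.toGaloisRep VQ) γ x) =
        (rationalTateGaloisRepOf (geomPoints W) ℓ hcW) γ (eV x) := fun γ x ↦ heV γ x
  have hconj := ContinuousRep.inertiaCoinvariantsCongr_conj_toInertiaCoinvariants _ _ eV heV' 𝔔 σ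
  have h3 : ((rationalTateGaloisRepOf (geomPoints W) ℓ hcW).toInertiaCoinvariants 𝔔 σ).charpoly =
      ((FramedGaloisRep.toGaloisRep VQ).toInertiaCoinvariants 𝔔 σ).charpoly := by
    rw [← hconj, LinearEquiv.charpoly_conj]
  have hE := W.reverse_charpoly_toInertiaCoinvariants_eq_localPolynomialAt' ℓ hℓw h𝔔 σ hσ
  rw [h3] at hE
  rw [hE, Polynomial.map_map] at h1
  -- (4) read in `ℂ` through `ι`: `L_w(W, T) = 1 - a_p(f₀) T` in `ℂ[T]`
  have h4 := congrArg (Polynomial.map (ι : PadicAlgCl ℓ →+* ℂ)) h1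
  rw [Polynomial.map_map, RingHom.eq_intCast' (((ι : PadicAlgCl ℓ →+* ℂ).comp
    ((algebraMap ℚ_[ℓ] (PadicAlgCl ℓ)).comp (Int.castRingHom ℚ_[ℓ]))))] at h4
  simp only [Polynomial.map_sub, Polynomial.map_mul, Polynomial.map_one, map_X, map_C,
    RingEquiv.coe_toRingHom, RingEquiv.apply_symm_apply] at h4
  -- (5) compare `X`-coefficients, by reduction type at `w`
  have h5 := congrArg (fun P : ℂ[X] ↦ P.coeff 1) h4
  simp only [Polynomial.coeff_map, eq_intCast, coeff_lin_one] at h5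
  rcases hasGoodReductionAt_or_hasMultiplicativeReductionAt_or_hasAdditiveReductionAt w W with
    hg | hm | ha
  · rw [localPolynomialAt_of_hasGoodReductionAt hg, coeff_quad_one] at h5
    have hL := LFunction_primesEquiv_eq_frobeniusTraceAt W w hg
    rw [hwp] at hL
    rw [hL]
    push_cast at h5
    linear_combination h5
  · by_cases hs : W.HasSplitMultiplicativeReductionAt w
    · rw [localPolynomialAt_of_hasSplitMultiplicativeReductionAt hs] at h5
      have hL := W.LFunction_apply_primesEquiv_of_hasSplitMultiplicativeReductionAt hs
      rw [hwp] at hL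
      rw [hL]
      norm_num [Polynomial.coeff_one] at h5
      push_cast
      linear_combination -h5
    · rw [localPolynomialAt_of_hasMultiplicativeReductionAt_of_not_hasSplitMultiplicativeReductionAt
        hm hs] at h5
      have hL := W.LFunction_apply_primesEquiv_of_hasMultiplicativeReductionAt_of_not_split hm hs
      rw [hwp] at hL
      rw [hL]
      norm_num [Polynomial.coeff_one] at h5
      push_cast
      linear_combination h5
  · rw [localPolynomialAt_of_hasAdditiveReductionAt ha] at h5
    have hL := W.LFunction_apply_primesEquiv_of_hasAdditiveReductionAt ha
    rw [hwp] at hL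
    rw [hL]
    norm_num [Polynomial.coeff_one] at h5
    push_cast
    linear_combination h5

end Transport

/-! ## G6c — closers from the Steinberg corner, and the squarefull corner (no Euler factors) -/

section SteinbergClosers

/-- **G6a ⇒ L2** (the residual typed in gen 5 follows from the Steinberg corner alone; the level
hypothesis `N = N_W` of `SteinbergSignPacket` is not even used). [cite: DarmonDiamondTaylor1995, Thm. 3.1 (e)] -/
theorem steinbergSignPacket_of_carayolSteinbergGamma0 (hCS : CarayolSteinbergGamma0) :
    SteinbergSignPacket := by
  intro W _ N _ f₀ hf₀ _ hgood hap p hp hpN hp2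
  exact cuspCoeff_eq_lFunction_of_carayolSteinbergGamma0 W f₀ hCS hf₀ hgood hap hp hpN hp2

/-- **L2a (gen 5, now PROVED) — C_E ⇒ the Steinberg sign bit.** [cite: CarayolASENS1986, Thm. (A)] -/
theorem steinbergSignPacket_of_carayol1986_eulerFactor (hCE : Carayol1986_eulerFactor) :
    SteinbergSignPacket :=
  steinbergSignPacket_of_carayolSteinbergGamma0 (carayolSteinbergGamma0_of_carayol1986_eulerFactor hCE)

/-- **Plan closer (gen 6) — the VERBATIM stub from {`SomeLevelPacket`, Carayol (A), Saito's `p = 2`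
leaf, `CarayolSteinbergGamma0`}.** [cite: BCDTJAMS2001, Introduction ((3) ⇒ (2))]
[cite: CarayolASENS1986, Thm. (A)] [cite: DarmonDiamondTaylor1995, Thm. 3.1 (d), (e)] -/
theorem stub_threeImpTwo_of_steinberg_leaves (hPk : SomeLevelPacket)
    (hC : Carayol1986_artinConductorExponent)
    (hS : ∀ (V : WeierstrassCurve ℚ) (ℓ : ℕ) [Fact ℓ.Prime],
      V.swanConductorAt_rationalTate_eq_wildConductorExponent_of_ringChar_eq_two ℓ)
    (hCS : CarayolSteinbergGamma0) :
    ∀ (W : WeierstrassCurve ℚ) [W.IsElliptic] [NeZero (W.conductorNorm ℤ)] (ℓ : ℕ) [Fact ℓ.Prime],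
      W.IsModularGaloisRepTate ℓ → BCDT.IsModular W :=
  stub_threeImpTwo_of_packet_leaves hPk hC hS (steinbergSignPacket_of_carayolSteinbergGamma0 hCS)

/-- The same with the whole of Carayol's Euler-factor theorem (gen 5's closing set, now sorry-free).
[cite: CarayolASENS1986, Thm. (A)] -/
theorem stub_threeImpTwo_of_packet_leaves_of_carayol1986_eulerFactor (hPk : SomeLevelPacket)
    (hC : Carayol1986_artinConductorExponent)
    (hS : ∀ (V : WeierstrassCurve ℚ) (ℓ : ℕ) [Fact ℓ.Prime],
      V.swanConductorAt_rationalTate_eq_wildConductorExponent_of_ringChar_eq_two ℓ)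
    (hCE : Carayol1986_eulerFactor) :
    ∀ (W : WeierstrassCurve ℚ) [W.IsElliptic] [NeZero (W.conductorNorm ℤ)] (ℓ : ℕ) [Fact ℓ.Prime],
      W.IsModularGaloisRepTate ℓ → BCDT.IsModular W :=
  stub_threeImpTwo_of_packet_leaves hPk hC hS (steinbergSignPacket_of_carayol1986_eulerFactor hCE)

/-- **G6c — the squarefull corner (PROVED, no Euler-factor input at all).**  If every bad prime of `W`
is additive (`p ∣ N_W ⇒ p² ∣ N_W`), the packet newform at any level is THE newform of `W`: the level is
`N_W` by Carayol (A) + Saito, and there is no prime `p ∥ N` at which a sign could differ.  (The opposite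
extreme from the route's Frey curves, which are multiplicative at every odd bad prime.)
[cite: CarayolASENS1986, Thm. (A), (0.8) Corollaire] [cite: AtkinLehner1970, Thm. 3] -/
theorem isModular_of_packet_of_carayol1986_of_saito_of_squarefull
    (hC : Carayol1986_artinConductorExponent) (W : WeierstrassCurve ℚ) [W.IsElliptic]
    [NeZero (W.conductorNorm ℤ)]
    (hS : ∀ (ℓ : ℕ) [Fact ℓ.Prime],
      W.swanConductorAt_rationalTate_eq_wildConductorExponent_of_ringChar_eq_two ℓ)
    (hsq : ∀ p : ℕ, p.Prime → p ∣ W.conductorNorm ℤ → p ^ 2 ∣ W.conductorNorm ℤ)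
    {N : ℕ} [NeZero N] (f₀ : CuspForm (Gamma0 N) 2) (hf₀ : IsNewform0 f₀)
    (hgood : ∀ v : HeightOneSpectrum (𝓞 ℚ), ¬ ((primesEquiv v : ℕ) ∣ N) → W.HasGoodReductionAt v)
    (hap : ∀ p : ℕ, p.Prime → ¬ p ∣ N → cuspCoeff f₀ p = (W.LFunction p : ℂ)) :
    BCDT.IsModular W := by
  have hN : N = W.conductorNorm ℤ :=
    level_eq_conductorNorm_of_carayol1986_of_saito_of_packet W f₀ hC hS hf₀ hgood hap
  subst hN
  exact ⟨f₀, isNewformOf_of_packet_of_level_eq_of_sign W f₀ hf₀ rfl hap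
    fun p hp hpN hp2 ↦ absurd (hsq p hp hpN) hp2⟩

end SteinbergClosers

/-! ## G6d — the route's instances: Frey curves, explicit Steinberg signs -/

section Frey

variable {A B : ℤ}

/-- **F1₀ (helper stub, M) — split ⟺ `B` is a square mod `q`, at an odd prime `q ∣ A`.**  For coprime
`A, B` with `AB(A+B) ≠ 0` the model `y² = x(x-A)(x+B)` is minimal at `q` with multiplicative reduction
(`isMinimalAt_freyIntModel_of_ne_two`, `hasMultiplicativeReductionAt_freyCurve_of_ne_two`); its
reduction `y² = x²(x + B)` has node `(0,0)` with tangents `y = ±√B·x`, so the reduction is split iff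
`B ∈ (𝔽_q^×)²`; equivalently `-c₄c₆ = 512(A²+AB+B²)(B-A)(2A+B)(A+2B) ≡ 1024 B⁵ (mod q)` is a square
(the tree's criterion `hasSplitMultiplicativeReductionAt_iff_isSquare`, ported from `IsGloballyMinimal`
to a model minimal at `v` via `hasSplitMultiplicativeReduction_iff_of_isMinimal_of_eq_smul`).
[cite: SilvermanAEC2009, VII.5 Prop. 5.1 (b)] [cite: Serre1987, §4.1 (4.1.2)] -/
theorem hasSplitMultiplicativeReductionAt_freyCurve_iff_of_dvd_left (hAB : IsCoprime A B)
    (h0 : A * B * (A + B) ≠ 0) {q : ℕ} [Fact q.Prime] (hq2 : q ≠ 2) (hqA : (q : ℤ) ∣ A)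
    (v : HeightOneSpectrum (𝓞 ℚ)) (hv : (q : 𝓞 ℚ) ∈ v.asIdeal) :
    (freyCurve A B).HasSplitMultiplicativeReductionAt v ↔ IsSquare ((B : ℤ) : ZMod q) := by
  sorry

/-- **F1a (helper stub, S given F1₀) — `a_q(E_{A,B}) = (B/q)` at an odd prime `q ∣ A`.**
(`LFunction_apply_primesEquiv_of_hasSplitMultiplicativeReductionAt` / `…_of_not_split`,
`legendreSym.eq_one_iff`, `B ≢ 0` by coprimality.)  kit job j344703 (gen 5): 0/11756 mismatches.
[cite: SilvermanAEC2009, §C.16 and VII.5 Prop. 5.1 (b)] -/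
theorem lFunction_freyCurve_of_dvd_left (hAB : IsCoprime A B) (h0 : A * B * (A + B) ≠ 0)
    {q : ℕ} [Fact q.Prime] (hq2 : q ≠ 2) (hqA : (q : ℤ) ∣ A) :
    (freyCurve A B).LFunction q = legendreSym q B := by
  sorry

/-- **F1b (helper stub) — `a_q(E_{A,B}) = (-A/q)` at an odd prime `q ∣ B`** (`-c₄c₆ ≡ -1024 A⁵`).
[cite: SilvermanAEC2009, §C.16 and VII.5 Prop. 5.1 (b)] -/
theorem lFunction_freyCurve_of_dvd_right (hAB : IsCoprime A B) (h0 : A * B * (A + B) ≠ 0)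
    {q : ℕ} [Fact q.Prime] (hq2 : q ≠ 2) (hqB : (q : ℤ) ∣ B) :
    (freyCurve A B).LFunction q = legendreSym q (-A) := by
  sorry

/-- **F1c (helper stub) — `a_q(E_{A,B}) = (A/q)` at an odd prime `q ∣ A + B`** (`-c₄c₆ ≡ 1024 A⁵`).
[cite: SilvermanAEC2009, §C.16 and VII.5 Prop. 5.1 (b)] -/
theorem lFunction_freyCurve_of_dvd_add (hAB : IsCoprime A B) (h0 : A * B * (A + B) ≠ 0)
    {q : ℕ} [Fact q.Prime] (hq2 : q ≠ 2) (hqC : (q : ℤ) ∣ A + B) :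
    (freyCurve A B).LFunction q = legendreSym q A := by
  sorry

/-- **`FreySteinbergSign` — the residual cut to the route's instances (I1/I3).**  For coprime `A, B`
with `AB(A+B) ≠ 0` and a packet newform `f₀ ∈ S₂(Γ₀(N))` of `E_{A,B}` at level `N = N_E`:
`a_q(f₀) = a_q(E_{A,B})` at every `q ∥ N` — by F1a–c the right-hand side is the explicit Legendre symbol
at odd `q` (every odd bad prime of `E_{A,B}` is multiplicative, Serre (4.1.2)); `q = 2` enters only when
`E_{A,B}` is semistable at `2` (`16 ∣ B` up to the `S₃`-symmetry). [cite: Serre1987, §4.1 (4.1.2)]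
[cite: DarmonDiamondTaylor1995, Thm. 3.1 (e)] -/
def FreySteinbergSign : Prop :=
  ∀ (A B : ℤ), IsCoprime A B → A * B * (A + B) ≠ 0 →
    ∀ {N : ℕ} [NeZero N] (f₀ : CuspForm (Gamma0 N) 2), IsNewform0 f₀ →
      N = (freyCurve A B).conductorNorm ℤ →
      (∀ v : HeightOneSpectrum (𝓞 ℚ), ¬ ((primesEquiv v : ℕ) ∣ N) →
        (freyCurve A B).HasGoodReductionAt v) →
      (∀ p : ℕ, p.Prime → ¬ p ∣ N → cuspCoeff f₀ p = ((freyCurve A B).LFunction p : ℂ)) →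
      ∀ q : ℕ, q.Prime → q ∣ N → ¬ q ^ 2 ∣ N → cuspCoeff f₀ q = ((freyCurve A B).LFunction q : ℂ)

/-- `SteinbergSignPacket ⇒ FreySteinbergSign` (specialisation; `isElliptic_freyCurve`). [folklore] -/
theorem freySteinbergSign_of_steinbergSignPacket (h : SteinbergSignPacket) : FreySteinbergSign := by
  intro A B _ h0 N _ f₀ hf₀ hN hgood hap q hq hqN hq2
  haveI := isElliptic_freyCurve h0
  exact h (freyCurve A B) f₀ hf₀ hN hgood hap q hq hqN hq2

/-- `CarayolSteinbergGamma0 ⇒ FreySteinbergSign`. [cite: DarmonDiamondTaylor1995, Thm. 3.1 (e)] -/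
theorem freySteinbergSign_of_carayolSteinbergGamma0 (hCS : CarayolSteinbergGamma0) :
    FreySteinbergSign :=
  freySteinbergSign_of_steinbergSignPacket (steinbergSignPacket_of_carayolSteinbergGamma0 hCS)

/-- **Frey closer** — for a Frey curve `W = E_{A,B}`: {packet, Carayol (A), Saito leaf of `W`,
`FreySteinbergSign`} ⇒ `(3) ⇒ (2)` for `W` (the shape k2's recut `SigThreeImpTwoFreyCS` consumes).
[cite: BCDTJAMS2001, Introduction ((3) ⇒ (2))] -/
theorem isModular_frey_of_packet_leaves (hPk : SomeLevelPacket) (hC : Carayol1986_artinConductorExponent)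
    (hSign : FreySteinbergSign) (hAB : IsCoprime A B) (h0 : A * B * (A + B) ≠ 0)
    (W : WeierstrassCurve ℚ) [W.IsElliptic] [NeZero (W.conductorNorm ℤ)] (hW : W = freyCurve A B)
    (hS : ∀ (ℓ : ℕ) [Fact ℓ.Prime],
      W.swanConductorAt_rationalTate_eq_wildConductorExponent_of_ringChar_eq_two ℓ)
    (ℓ : ℕ) [Fact ℓ.Prime] (hmod : W.IsModularGaloisRepTate ℓ) : BCDT.IsModular W := by
  obtain ⟨N, hN, f₀, hf₀, hgood, hap⟩ := hPk W ℓ hmod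
  have hNc : N = W.conductorNorm ℤ :=
    level_eq_conductorNorm_of_carayol1986_of_saito_of_packet W f₀ hC hS hf₀ hgood hap
  subst hW
  have hWf := isNewformOf_of_packet_of_level_eq_of_sign (freyCurve A B) f₀ hf₀ hNc hap
    (hSign A B hAB h0 f₀ hf₀ hNc hgood hap)
  subst hNc
  exact ⟨f₀, hWf⟩

end Frey

end Summit.ABC.ABC.Cruxes.FreyModularity.Sketch.ThreeImpTwoIdeas3g6

end
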